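import Summits.AtomisticToContinuum.FouriersLaw.Theorems.CageBudgetFeketeHeatVarianceCalculus
import Literature.MathematicalPhysics.KineticTheory.InfiniteChainCurrentPositiveType
import HarnessLib

/-!
# Stub `stub_currentCorrelationBasics` of line `Sketch`
(crux `CoercivePulse.AbelRegularity`, item stmt-AtomisticToContinuum-15384; `--supports` file, closes nothing)

WHAT. The registered stub S1 of the crux's skeleton (`Cruxes/AbelRegularity/Lines/Sketch.lean`): in the crux's arena —
the pinned anharmonic chain `pinnedChain ω₂ lam β γ` (`ω₂, lam, β > 0`), a shift- and momentum-reversal-invariant DLR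
state `μ` at `T > 0`, a `μ`-preserving a.e. shift-covariant dynamics `D` with absolutely convergent summed current
correlations `C(t) = D.currentCorrelation μ t` — the summed current autocorrelation is continuous, bounded by its
value at zero (`|C(t)| ≤ C(0)`), and its Abel means are non-negative: `∫₀^∞ e^{-νt} C(t) dt ≥ 0` for every `ν > 0`.

HOW (assembly of landed theorems). (1) The proved route item `CageBudgetFekete.HeatVarianceCalculus`
(`Theorems.HeatVarianceCalculus.CanonicalRigidity.heatVarianceCalculus_proof`) gives, for the guarded pair, continuity
of `C`, `V(τ) = 2∫_{(0,τ]}(τ-s)C(s)ds ≥ 0` for `τ ≥ 0`, and the Laplace identity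
`∫₀^∞e^{-νt}C = (ν²/2)∫₀^∞e^{-νt}V`; hence `A(ν) ≥ 0`. (2) Dynamics rigidity
(`CanonicalRigidity.flow_ae_eq_canonical`): `D` agrees `μ`-a.e. at all times with the canonical Buttà–Marchioro
dynamics `D♭` of `OscillatorChain.exists_bmDynamics` (carrier `bmGood`), so `C = C♭` termwise, `D♭` inherits absolute
convergence, and the in-tree positive type of `C♭`
(`InfiniteChainDynamics.currentCorrelation_positiveType_of_carrier_subset_bmGood`) gives `|C| ≤ C(0)`.
The Laplace-integrability hypothesis of the stub is idle.

[cite: Helfand1960] [cite: ButtaMarchioro2016, §2 Thm 2.1, eq. (2.6) and §3]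
-/

noncomputable section

namespace Summit.AtomisticToContinuum.FouriersLaw.Theorems.AbelRegularity.Sketch

open MeasureTheory Filter Set Function
open scoped Topology BigOperators
open Literature.MathematicalPhysics.KineticTheory.HeatConduction

/-- **Stub S1 `stub_currentCorrelationBasics` (registered signature, verbatim): basics of the summed current
autocorrelation under the crux guard.** `t ↦ C(t) = D.currentCorrelation μ t` is continuous, `|C(t)| ≤ C(0)` for all
`t`, and `∫₀^∞ e^{-νt}C(t)dt ≥ 0` for `ν > 0`. Continuity and `A ≥ 0` come from the landed heat-variance calculus
(`heatVarianceCalculus_proof`: `V ≥ 0` and `A = (ν²/2)∫e^{-νt}V`); the bound `|C| ≤ C(0)` by dynamics rigidity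
(`flow_ae_eq_canonical`) from the positive type of the canonical Buttà–Marchioro autocorrelation
(`currentCorrelation_positiveType_of_carrier_subset_bmGood`). [folklore] -/
theorem stub_currentCorrelationBasics :
    ∀ ω₂ lam β γ : ℝ, 0 < ω₂ → 0 < lam → 0 < β → ∀ T : ℝ, 0 < T → ∀ μ : MeasureTheory.Measure Literature.MathematicalPhysics.KineticTheory.HeatConduction.ChainConfig, (Literature.MathematicalPhysics.KineticTheory.HeatConduction.pinnedChain ω₂ lam β γ).IsChainGibbsMeasure T μ → Literature.MathematicalPhysics.KineticTheory.HeatConduction.IsShiftInvariant μ → μ.map (fun σ : Literature.MathematicalPhysics.KineticTheory.HeatConduction.ChainConfig => fun x : ℤ => ((σ x).1, -(σ x).2)) = μ → ∀ D : Literature.MathematicalPhysics.KineticTheory.HeatConduction.InfiniteChainDynamics (Literature.MathematicalPhysics.KineticTheory.HeatConduction.pinnedChain ω₂ lam β γ), D.PreservesMeasure μ → (∀ t : ℝ, ∀ᵐ σ ∂μ, D.flow t (Literature.MathematicalPhysics.KineticTheory.HeatConduction.shift σ) = Literature.MathematicalPhysics.KineticTheory.HeatConduction.shift (D.flow t σ))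 → (∀ t : ℝ, D.HasAbsConvergentCorrelation μ t) → (∀ ν : ℝ, 0 < ν → MeasureTheory.IntegrableOn (fun t : ℝ => Real.exp (-(ν * t)) * D.currentCorrelation μ t) (Set.Ioi 0)) → Continuous (fun t : ℝ => D.currentCorrelation μ t) ∧ (∀ t : ℝ, |D.currentCorrelation μ t| ≤ D.currentCorrelation μ 0) ∧ ∀ ν : ℝ, 0 < ν → 0 ≤ ∫ t in Set.Ioi (0:ℝ), Real.exp (-(ν * t)) * D.currentCorrelation μ t := by
  intro ω₂ lam β γ hω hl hβ T hT μ hG hSI hR D hP hSh hAC _hInt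
  -- (1) the landed heat-variance calculus of the guarded pair: continuity, `V ≥ 0`, Laplace identity
  have hHV : Summit.AtomisticToContinuum.FouriersLaw.Theses.CageBudgetFekete.HeatVarianceCalculus :=
    Summit.AtomisticToContinuum.FouriersLaw.Theorems.HeatVarianceCalculus.CanonicalRigidity.heatVarianceCalculus_proof
  obtain ⟨-, hC, hV⟩ := hHV ω₂ lam β γ hω hl hβ T hT μ hG hSI hR D hP hSh
  obtain ⟨hVpos, hLap⟩ := hV _ rfl
  -- (2) superstability of the shift-invariant Gibbs state and the polynomial data of the chain (in tree)
  have hss : (pinnedChain ω₂ lam β γ).HasSuperstabilityEstimate μ :=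
    OscillatorChain.hasSuperstabilityEstimate_of_isShiftInvariant_pinnedChain γ hω hl.le hβ.le hT hG hSI
  have hU0 : ∀ q : ℝ, 0 ≤ (pinnedChain ω₂ lam β γ).U q :=
    OscillatorChain.pinnedChain_U_nonneg β γ hω.le hl.le
  have hUm : Measurable (pinnedChain ω₂ lam β γ).U := OscillatorChain.measurable_pinnedChain_U ω₂ lam β γ
  have hU2 : OscillatorChain.IsEvenPolyOfDegree (pinnedChain ω₂ lam β γ).U 2 :=
    OscillatorChain.pinnedChain_isEvenPolyOfDegree_U β γ hω.le hl
  have hV2 : OscillatorChain.IsEvenPolyOfDegree (pinnedChain ω₂ lam β γ).V 2 :=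
    OscillatorChain.pinnedChain_isEvenPolyOfDegree_V ω₂ lam γ hβ
  -- the canonical Buttà–Marchioro dynamics `D♭` (carrier `bmGood`) and RIGIDITY: `D = D♭` a.e. at all times
  obtain ⟨D', hcar, -, -, -, -, -, hpresAll⟩ :=
    OscillatorChain.exists_bmDynamics (P := pinnedChain ω₂ lam β γ) one_le_two one_le_two hU2 hV2
  have hP' : D'.PreservesMeasure μ := hpresAll T μ hG hss
  have hrig : ∀ᵐ σ ∂μ, ∀ t : ℝ, D.flow t σ = D'.flow t σ :=
    Summit.AtomisticToContinuum.FouriersLaw.Theorems.HeatVarianceCalculus.CanonicalRigidity.flow_ae_eq_canonical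
      γ hω hl hβ hT hG hSI D D' hP hcar
  have hterm : ∀ (t : ℝ) (x : ℤ),
      ∫ σ, (pinnedChain ω₂ lam β γ).bondCurrentZ σ 0 *
          (pinnedChain ω₂ lam β γ).bondCurrentZ (D.flow t σ) x ∂μ =
        ∫ σ, (pinnedChain ω₂ lam β γ).bondCurrentZ σ 0 *
          (pinnedChain ω₂ lam β γ).bondCurrentZ (D'.flow t σ) x ∂μ := fun t x => by
    refine integral_congr_ae ?_
    filter_upwards [hrig] with σ hσ
    rw [hσ t]
  have hCC' : ∀ t : ℝ, D.currentCorrelation μ t = D'.currentCorrelation μ t := fun t => by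
    unfold InfiniteChainDynamics.currentCorrelation
    exact tsum_congr fun x => hterm t x
  have hAC' : ∀ t : ℝ, D'.HasAbsConvergentCorrelation μ t := fun t => by
    refine ⟨fun x => hss.integrable_bondCurrentZ_mul_comp one_le_two hU0 hUm hV2 (hP'.2 t) x 0, ?_⟩
    have h := (hAC t).2
    simp only [hterm] at h
    exact h
  -- positive type of the canonical autocorrelation (carrier `= bmGood`), in tree: `|C♭| ≤ C♭(0)`
  obtain ⟨-, hbd', -⟩ :=
    D'.currentCorrelation_positiveType_of_carrier_subset_bmGood one_le_two one_le_two hU2 hV2 hss hSI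
      hcar.le hP' hAC'
  refine ⟨hC, fun t => ?_, fun ν hν => ?_⟩
  · rw [hCC' t, hCC' 0]
    exact hbd' t
  · -- (3) `A(ν) = (ν²/2) ∫₀^∞ e^{-νt} V(t) dt ≥ 0` since `V ≥ 0` on `[0, ∞)`
    obtain ⟨-, -, hEq⟩ := hLap ν hν
    rw [hEq]
    refine mul_nonneg (by positivity) (setIntegral_nonneg measurableSet_Ioi fun t ht => ?_)
    exact mul_nonneg (Real.exp_pos _).le (hVpos t (le_of_lt (Set.mem_Ioi.1 ht)))

end Summit.AtomisticToContinuum.FouriersLaw.Theorems.AbelRegularity.Sketch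

end
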